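import Literature.Geometry.Lorentzian.KerrRadiusPseudoconvexityKS
import Literature.Geometry.Lorentzian.KerrSchildTimeTranslation
import Summits.FinalStateConjecture.FinalStateConjecture.Theorems.BartnikGapSettlingGapExhaustionCylindersBendInwardOf
import Summits.FinalStateConjecture.FinalStateConjecture.Theorems.SwallowTheDatumKerrShieldedSettlesStubKerrExteriorFlatDecayAux
import HarnessLib

/-!
# Crux `GapExhaustion` (stmt-FinalStateConjecture-10808), line `photon-shell-pseudoconvexity`:
# stub (B) `stub_kerrCylindersExactMargin` — uniform inward bending of the Kerr cylinders

Route `BartnikGapSettling`; helper (`--supports stmt-FinalStateConjecture-10808`) landing the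
registered sub-stub (B) of the reshaped `KerrCylindersBendInward` (shared geometric input of the
photon-shell line's S5 and of the eternal-redshift line's `stub_kerrCylindersBendInward`, in
Ionescu–Klainerman's Hessian form): **for a band `r₊ < r_lo ≤ r ≤ r_e < r_ph⁺` there is `m > 0`
such that at every point of the band (all Kerr-star times) every null vector tangent to the
cylinder has `Hess r(w, w) ≤ −m‖w‖²`** (exact Kerr, Kerr–Schild Cartesian coordinates).

The pointwise strict sign is `Kerr.hessAt_radius_neg` (Literature
`KerrRadiusPseudoconvexityKS.lean`, axis included). Uniformity: the constraint set
`{(z, w) : z⁰ = 0, r_lo ≤ r(z) ≤ r_e, ‖w‖ = 1, g_z(w,w) = 0, dr_z(w) = 0}` is compact and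
`(z, w) ↦ Hess r_z(w,w)` is continuous on it, so its maximum is `< 0`; homogeneity in `w` and
stationarity of Kerr (`Kerr.bilin_add_time`, `Kerr.radius_add_time_smul_basisVector`, and the
translation naturality `kerrCylindersBendInward_hessAt_comp_add_right` of the glue file) remove
the normalisations. With (C) `stub_hessMarginStable` (p123608) and the glue (E)
`stub_kerrCylindersBendInward_of` (p123675) this closes `KerrCylindersBendInward'`.
-/

noncomputable section

-- instance search through the nested operator types `E4 →L[ℝ] E4 →L[ℝ] E4 →L[ℝ] ℝ`
set_option maxSynthPendingDepth 3

-- D-0017: single-problem summit, `Summit.<S>.<S>.…` by design (cf. lakefile `weak.linter.dupNamespace`).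
set_option linter.dupNamespace false

namespace Summit.FinalStateConjecture.FinalStateConjecture.Theorems

open Set Literature.Geometry.Lorentzian Literature.Geometry.Lorentzian.MetricCoord
open scoped Topology ContDiff

/-- `z ↦ Hess r_z` is continuous on the Kerr chart domain as a bilinear-form-valued map
(`D²r`, `dr`, `Γ` are `C^∞` there). -/
theorem kerrCylindersExactMargin_continuousOn_hessAt (M a r₀ : ℝ) :
    ContinuousOn (fun z : E4 ↦ hessAt (Kerr.bilin M a) (Kerr.radius a) z) (Kerr.region a r₀) := by
  have hG := KerrSchildChart.isMetricOn_kerrBilin M a r₀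
  have hr : ContDiffOn ℝ ∞ (Kerr.radius a) (Kerr.region a r₀ : Set E4) :=
    Kerr.contDiffOn_radius_region a r₀
  have hop : IsOpen (Kerr.region a r₀ : Set E4) := (Kerr.region a r₀).isOpen
  have h1 : ContinuousOn (fderiv ℝ (Kerr.radius a)) (Kerr.region a r₀) :=
    hr.continuousOn_fderiv_of_isOpen hop (by exact_mod_cast le_top)
  have htop : (∞ : WithTop ℕ∞) + 1 ≤ ∞ := le_of_eq rfl
  have h2 : ContinuousOn (fderiv ℝ (fderiv ℝ (Kerr.radius a))) (Kerr.region a r₀) :=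
    (hr.fderiv_of_isOpen hop htop).continuousOn_fderiv_of_isOpen hop (by exact_mod_cast le_top)
  have h3 : ContinuousOn (chrAt (Kerr.bilin M a)) (Kerr.region a r₀) := hG.contDiffOn_chrAt.continuousOn
  have h4 : ContinuousOn
      (fun z : E4 ↦ (ContinuousLinearMap.compL ℝ E4 E4 ℝ (fderiv ℝ (Kerr.radius a) z)).comp
        (chrAt (Kerr.bilin M a) z)) (Kerr.region a r₀) :=
    ((ContinuousLinearMap.compL ℝ E4 E4 ℝ).continuous.comp_continuousOn h1).clm_comp h3
  exact (h2.sub h4).congr fun z _ ↦ rfl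

/-- `(z, w) ↦ Hess r_z(w, w)` is continuous on `region × E4`. -/
theorem kerrCylindersExactMargin_continuousOn_hessAt_apply (M a r₀ : ℝ) :
    ContinuousOn (fun p : E4 × E4 ↦ hessAt (Kerr.bilin M a) (Kerr.radius a) p.1 p.2 p.2)
      ((Kerr.region a r₀ : Set E4) ×ˢ (univ : Set E4)) := by
  have h : ContinuousOn (fun p : E4 × E4 ↦ hessAt (Kerr.bilin M a) (Kerr.radius a) p.1)
      ((Kerr.region a r₀ : Set E4) ×ˢ (univ : Set E4)) :=
    (kerrCylindersExactMargin_continuousOn_hessAt M a r₀).comp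
      (continuous_fst : Continuous (Prod.fst : E4 × E4 → E4)).continuousOn (fun p hp ↦ (mem_prod.1 hp).1)
  exact (h.clm_apply (continuous_snd : Continuous (Prod.snd : E4 × E4 → E4)).continuousOn).clm_apply (continuous_snd : Continuous (Prod.snd : E4 × E4 → E4)).continuousOn

/-- `(z, w) ↦ g_z(w, w)` is continuous on `region × E4`. -/
theorem kerrCylindersExactMargin_continuousOn_bilin_apply (M a r₀ : ℝ) :
    ContinuousOn (fun p : E4 × E4 ↦ Kerr.bilin M a p.1 p.2 p.2)
      ((Kerr.region a r₀ : Set E4) ×ˢ (univ : Set E4)) := by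
  have h : ContinuousOn (fun p : E4 × E4 ↦ Kerr.bilin M a p.1)
      ((Kerr.region a r₀ : Set E4) ×ˢ (univ : Set E4)) :=
    ((KerrSchildChart.isMetricOn_kerrBilin M a r₀).contDiffOn.continuousOn).comp
      (continuous_fst : Continuous (Prod.fst : E4 × E4 → E4)).continuousOn (fun p hp ↦ (mem_prod.1 hp).1)
  exact (h.clm_apply (continuous_snd : Continuous (Prod.snd : E4 × E4 → E4)).continuousOn).clm_apply (continuous_snd : Continuous (Prod.snd : E4 × E4 → E4)).continuousOn

/-- `(z, w) ↦ dr_z(w)` is continuous on `region × E4`. -/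
theorem kerrCylindersExactMargin_continuousOn_fderiv_radius_apply (a r₀ : ℝ) :
    ContinuousOn (fun p : E4 × E4 ↦ fderiv ℝ (Kerr.radius a) p.1 p.2)
      ((Kerr.region a r₀ : Set E4) ×ˢ (univ : Set E4)) := by
  have h1 : ContinuousOn (fderiv ℝ (Kerr.radius a)) (Kerr.region a r₀) :=
    (Kerr.contDiffOn_radius_region a r₀).continuousOn_fderiv_of_isOpen (Kerr.region a r₀).isOpen
      (by exact_mod_cast le_top)
  have h : ContinuousOn (fun p : E4 × E4 ↦ fderiv ℝ (Kerr.radius a) p.1)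
      ((Kerr.region a r₀ : Set E4) ×ˢ (univ : Set E4)) :=
    h1.comp (continuous_fst : Continuous (Prod.fst : E4 × E4 → E4)).continuousOn
      (fun p hp ↦ (mem_prod.1 hp).1)
  exact h.clm_apply (continuous_snd : Continuous (Prod.snd : E4 × E4 → E4)).continuousOn

/-- `Hess r` is invariant under Kerr-star time translations (Kerr is stationary). -/
theorem kerrCylindersExactMargin_hessAt_add_time (M a : ℝ) (z : E4) (t : ℝ) :
    hessAt (Kerr.bilin M a) (Kerr.radius a) (z + t • E4.basisVector 0) =
      hessAt (Kerr.bilin M a) (Kerr.radius a) z := by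
  have hG : (fun y : E4 ↦ Kerr.bilin M a (y + t • E4.basisVector 0)) = Kerr.bilin M a :=
    funext (Kerr.bilin_add_time M a t)
  have hf : (fun y : E4 ↦ Kerr.radius a (y + t • E4.basisVector 0)) = Kerr.radius a :=
    funext fun y ↦ Kerr.radius_add_time_smul_basisVector a y t
  have h := kerrCylindersBendInward_hessAt_comp_add_right (Kerr.bilin M a) (Kerr.radius a)
    (t • E4.basisVector 0) z
  rw [hG, hf] at h
  exact h.symm

/-- **Stub (B) of the reshaped `KerrCylindersBendInward` (crux `GapExhaustion`,
stmt-FinalStateConjecture-10808; lines photon-shell-pseudoconvexity S5 / eternal-redshift-rigidity)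
— uniform inward bending of the Kerr cylinders below the inner photon orbit.** For `0 < M`,
`|a| < M` and a band `r₊ < r_lo < r_e < r_ph⁺ = Kerr.photonOrbitRadius M (−|a|)` there is `m > 0`
such that at every point `z` of Kerr–Schild coordinate space with `r_lo ≤ r(z) ≤ r_e` (all times,
axis included) every vector `w` null for `g_{M,a}` and tangent to `{r = r(z)}` satisfies
`Hess r_z(w, w) ≤ −m‖w‖²`. Pointwise sign: `Kerr.hessAt_radius_neg`; uniformity by compactness of
the normalised constraint set on the slice `{z⁰ = 0}` and stationarity. -/
theorem stub_kerrCylindersExactMargin :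
    ∀ (M a r_lo r_e : ℝ), 0 < M → |a| < M → Kerr.rPlus M a < r_lo → r_lo < r_e →
      r_e < Kerr.photonOrbitRadius M (-|a|) →
      ∃ m : ℝ, 0 < m ∧ ∀ (z w : E4), r_lo ≤ Kerr.radius a z → Kerr.radius a z ≤ r_e →
        Kerr.bilin M a z w w = 0 → fderiv ℝ (Kerr.radius a) z w = 0 →
        hessAt (Kerr.bilin M a) (Kerr.radius a) z w w ≤ -m * ‖w‖ ^ 2 := by
  intro M a r_lo r_e hM ha hlo hloe he
  have hrp : 0 < Kerr.rPlus M a := by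
    have : M ≤ Kerr.rPlus M a := by
      unfold Kerr.rPlus; linarith [Real.sqrt_nonneg (M ^ 2 - a ^ 2)]
    linarith
  have hlo0 : 0 < r_lo := hrp.trans hlo
  -- the normalised constraint set on the slice `{z⁰ = 0}`
  set S : Set E4 := {z : E4 | z 0 = 0 ∧ r_lo ≤ Kerr.radius a z ∧ Kerr.radius a z ≤ r_e} with hS
  set K : Set (E4 × E4) := {p | p.1 ∈ S ∧ ‖p.2‖ = 1 ∧ Kerr.bilin M a p.1 p.2 p.2 = 0 ∧
    fderiv ℝ (Kerr.radius a) p.1 p.2 = 0} with hK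
  have hSc : IsCompact S := kerrCylindersBendInward_isCompact_slice a r_e hlo0
  have hSreg : S ⊆ (Kerr.region a 0 : Set E4) := fun z hz ↦ by
    have : max 0 0 < Kerr.radius a z := by rw [max_self]; exact hlo0.trans_le hz.2.1
    exact this
  have hB : IsCompact (S ×ˢ Metric.sphere (0 : E4) 1) := hSc.prod (isCompact_sphere 0 1)
  have hBreg : S ×ˢ Metric.sphere (0 : E4) 1 ⊆ (Kerr.region a 0 : Set E4) ×ˢ (univ : Set E4) :=
    prod_mono hSreg (subset_univ _)
  have hKeq : K = (S ×ˢ Metric.sphere (0 : E4) 1) ∩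
      (fun p : E4 × E4 ↦ Kerr.bilin M a p.1 p.2 p.2) ⁻¹' {0} ∩
      (fun p : E4 × E4 ↦ fderiv ℝ (Kerr.radius a) p.1 p.2) ⁻¹' {0} := by
    ext p
    simp only [hK, mem_setOf_eq, mem_inter_iff, mem_prod, mem_sphere_iff_norm, sub_zero,
      mem_preimage, mem_singleton_iff]
    tauto
  have hKc : IsCompact K := by
    have h1 : IsClosed ((S ×ˢ Metric.sphere (0 : E4) 1) ∩
        (fun p : E4 × E4 ↦ Kerr.bilin M a p.1 p.2 p.2) ⁻¹' {0}) :=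
      ((kerrCylindersExactMargin_continuousOn_bilin_apply M a 0).mono hBreg).preimage_isClosed_of_isClosed
        hB.isClosed isClosed_singleton
    have h2 : IsClosed ((S ×ˢ Metric.sphere (0 : E4) 1) ∩
        (fun p : E4 × E4 ↦ Kerr.bilin M a p.1 p.2 p.2) ⁻¹' {0} ∩
        (fun p : E4 × E4 ↦ fderiv ℝ (Kerr.radius a) p.1 p.2) ⁻¹' {0}) :=
      (((kerrCylindersExactMargin_continuousOn_fderiv_radius_apply a 0).mono hBreg).mono
        inter_subset_left).preimage_isClosed_of_isClosed h1 isClosed_singleton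
    rw [hKeq]
    exact hB.of_isClosed_subset h2 (inter_subset_left.trans inter_subset_left)
  -- the Hessian is continuous on `K` and negative there
  set F : E4 × E4 → ℝ := fun p ↦ hessAt (Kerr.bilin M a) (Kerr.radius a) p.1 p.2 p.2 with hF
  have hFc : ContinuousOn F K := by
    refine (kerrCylindersExactMargin_continuousOn_hessAt_apply M a 0).mono fun p hp ↦ ?_
    exact ⟨hSreg hp.1, mem_univ _⟩
  have hFneg : ∀ p ∈ K, F p < 0 := by
    rintro ⟨z, w⟩ ⟨hz, hw1, hnull, htan⟩
    have hw : w ≠ 0 := by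
      rintro rfl; simp at hw1
    exact Kerr.hessAt_radius_neg hM ha (hlo.trans_le hz.2.1) (lt_of_le_of_lt hz.2.2 he) hw hnull htan
  -- the margin
  obtain ⟨m, hm, hmK⟩ : ∃ m : ℝ, 0 < m ∧ ∀ p ∈ K, F p ≤ -m := by
    by_cases hne : K.Nonempty
    · obtain ⟨p₀, hp₀, hmax⟩ := hKc.exists_isMaxOn hne hFc
      refine ⟨-F p₀, by linarith [hFneg p₀ hp₀], fun p hp ↦ ?_⟩
      have := hmax hp
      simp only [mem_setOf_eq] at this
      linarith
    · refine ⟨1, one_pos, fun p hp ↦ ?_⟩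
      exact absurd ⟨p, hp⟩ hne
  refine ⟨m, hm, fun z w hz₁ hz₂ hnull htan ↦ ?_⟩
  by_cases hw : w = 0
  · subst hw; simp
  -- normalise: translate to the slice and rescale `w`
  set t : ℝ := z 0 with ht
  set z' : E4 := z + (-t) • E4.basisVector 0 with hz'
  clear_value t
  have hrad : Kerr.radius a z' = Kerr.radius a z := Kerr.radius_add_time_smul_basisVector a z (-t)
  have hbil : Kerr.bilin M a z' = Kerr.bilin M a z := Kerr.bilin_add_time M a (-t) z
  have hfd : fderiv ℝ (Kerr.radius a) z' = fderiv ℝ (Kerr.radius a) z :=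
    SwallowTheDatum.KerrShieldedSettles.KerrExteriorFlatDecay.fderiv_radius_add_time a z (-t)
  have hhess : hessAt (Kerr.bilin M a) (Kerr.radius a) z' = hessAt (Kerr.bilin M a) (Kerr.radius a) z :=
    kerrCylindersExactMargin_hessAt_add_time M a z (-t)
  have hz'0 : z' 0 = 0 := by
    simp [hz', ht, E4.basisVector]
  clear_value z'
  set c : ℝ := ‖w‖ with hc
  have hc0 : 0 < c := by rw [hc]; exact norm_pos_iff.2 hw
  clear_value c
  set v : E4 := c⁻¹ • w with hv
  clear_value v
  have hv1 : ‖v‖ = 1 := by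
    rw [hv, norm_smul, norm_inv, Real.norm_eq_abs, abs_of_pos hc0, ← hc, inv_mul_cancel₀ hc0.ne']
  have hwv : w = c • v := by
    rw [hv, smul_smul, mul_inv_cancel₀ hc0.ne', one_smul]
  have hnull' : Kerr.bilin M a z' v v = 0 := by
    rw [hbil, hv, map_smul, map_smul, smul_apply, smul_eq_mul, smul_eq_mul, hnull, mul_zero,
      mul_zero]
  have htan' : fderiv ℝ (Kerr.radius a) z' v = 0 := by
    rw [hfd, hv, map_smul, smul_eq_mul, htan, mul_zero]
  have hmem : (z', v) ∈ K := ⟨⟨hz'0, hrad ▸ hz₁, hrad ▸ hz₂⟩, hv1, hnull', htan'⟩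
  have hle : hessAt (Kerr.bilin M a) (Kerr.radius a) z v v ≤ -m := by
    have := hmK _ hmem
    simp only [hF] at this
    rwa [hhess] at this
  have hsc : hessAt (Kerr.bilin M a) (Kerr.radius a) z w w =
      c ^ 2 * hessAt (Kerr.bilin M a) (Kerr.radius a) z v v := by
    rw [hwv]
    simp only [map_smul, smul_apply, smul_eq_mul]
    ring
  rw [hsc]
  nlinarith [sq_nonneg c]

/-- **The outward companion (geometric input of the photon-shell line's S3, the inward sweep from
infinity): uniform OUTWARD bending of the Kerr cylinders beyond the outer photon orbit.** For
`0 < M`, `|a| < M` and a band `r_ph⁻ = Kerr.photonOrbitRadius M |a| < r_lo < r_e` there is `m > 0`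
such that at every band point every vector null for `g_{M,a}` and tangent to the cylinder has
`Hess r_z(w, w) ≥ m‖w‖²` (strong null pseudo-convexity towards `{r > c}`, Ionescu–Klainerman
Def. 1.1). Pointwise sign `Kerr.hessAt_radius_pos`; uniformity exactly as for the inward stub. Not a
registered stub (S3 takes the algebraic `PericentresBeyond` and does its own perturbation); recorded
here as the theorem-grade form of that input. -/
theorem kerrCylindersExactMarginOut :
    ∀ (M a r_lo r_e : ℝ), 0 < M → |a| < M → Kerr.photonOrbitRadius M |a| < r_lo → r_lo < r_e →
      ∃ m : ℝ, 0 < m ∧ ∀ (z w : E4), r_lo ≤ Kerr.radius a z → Kerr.radius a z ≤ r_e →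
        Kerr.bilin M a z w w = 0 → fderiv ℝ (Kerr.radius a) z w = 0 →
        m * ‖w‖ ^ 2 ≤ hessAt (Kerr.bilin M a) (Kerr.radius a) z w w := by
  intro M a r_lo r_e hM ha hlo hloe
  have hlo0 : 0 < r_lo := by
    have h3 : 3 * M ≤ Kerr.photonOrbitRadius M |a| := (Kerr.photonOrbitRadius_mem hM (abs_nonneg a)).1
    linarith
  -- the normalised constraint set on the slice `{z⁰ = 0}`
  set S : Set E4 := {z : E4 | z 0 = 0 ∧ r_lo ≤ Kerr.radius a z ∧ Kerr.radius a z ≤ r_e} with hS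
  set K : Set (E4 × E4) := {p | p.1 ∈ S ∧ ‖p.2‖ = 1 ∧ Kerr.bilin M a p.1 p.2 p.2 = 0 ∧
    fderiv ℝ (Kerr.radius a) p.1 p.2 = 0} with hK
  have hSc : IsCompact S := kerrCylindersBendInward_isCompact_slice a r_e hlo0
  have hSreg : S ⊆ (Kerr.region a 0 : Set E4) := fun z hz ↦ by
    have : max 0 0 < Kerr.radius a z := by rw [max_self]; exact hlo0.trans_le hz.2.1
    exact this
  have hB : IsCompact (S ×ˢ Metric.sphere (0 : E4) 1) := hSc.prod (isCompact_sphere 0 1)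
  have hBreg : S ×ˢ Metric.sphere (0 : E4) 1 ⊆ (Kerr.region a 0 : Set E4) ×ˢ (univ : Set E4) :=
    prod_mono hSreg (subset_univ _)
  have hKeq : K = (S ×ˢ Metric.sphere (0 : E4) 1) ∩
      (fun p : E4 × E4 ↦ Kerr.bilin M a p.1 p.2 p.2) ⁻¹' {0} ∩
      (fun p : E4 × E4 ↦ fderiv ℝ (Kerr.radius a) p.1 p.2) ⁻¹' {0} := by
    ext p
    simp only [hK, mem_setOf_eq, mem_inter_iff, mem_prod, mem_sphere_iff_norm, sub_zero,
      mem_preimage, mem_singleton_iff]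
    tauto
  have hKc : IsCompact K := by
    have h1 : IsClosed ((S ×ˢ Metric.sphere (0 : E4) 1) ∩
        (fun p : E4 × E4 ↦ Kerr.bilin M a p.1 p.2 p.2) ⁻¹' {0}) :=
      ((kerrCylindersExactMargin_continuousOn_bilin_apply M a 0).mono hBreg).preimage_isClosed_of_isClosed
        hB.isClosed isClosed_singleton
    have h2 : IsClosed ((S ×ˢ Metric.sphere (0 : E4) 1) ∩
        (fun p : E4 × E4 ↦ Kerr.bilin M a p.1 p.2 p.2) ⁻¹' {0} ∩
        (fun p : E4 × E4 ↦ fderiv ℝ (Kerr.radius a) p.1 p.2) ⁻¹' {0}) :=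
      (((kerrCylindersExactMargin_continuousOn_fderiv_radius_apply a 0).mono hBreg).mono
        inter_subset_left).preimage_isClosed_of_isClosed h1 isClosed_singleton
    rw [hKeq]
    exact hB.of_isClosed_subset h2 (inter_subset_left.trans inter_subset_left)
  -- the Hessian is continuous on `K` and negative there
  set F : E4 × E4 → ℝ := fun p ↦ hessAt (Kerr.bilin M a) (Kerr.radius a) p.1 p.2 p.2 with hF
  have hFc : ContinuousOn F K := by
    refine (kerrCylindersExactMargin_continuousOn_hessAt_apply M a 0).mono fun p hp ↦ ?_
    exact ⟨hSreg hp.1, mem_univ _⟩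
  have hFpos : ∀ p ∈ K, 0 < F p := by
    rintro ⟨z, w⟩ ⟨hz, hw1, hnull, htan⟩
    have hw : w ≠ 0 := by
      rintro rfl; simp at hw1
    exact Kerr.hessAt_radius_pos hM ha (hlo.trans_le hz.2.1) hw hnull htan
  -- the margin
  obtain ⟨m, hm, hmK⟩ : ∃ m : ℝ, 0 < m ∧ ∀ p ∈ K, m ≤ F p := by
    by_cases hne : K.Nonempty
    · obtain ⟨p₀, hp₀, hmin⟩ := hKc.exists_isMinOn hne hFc
      refine ⟨F p₀, hFpos p₀ hp₀, fun p hp ↦ ?_⟩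
      have := hmin hp
      simp only [mem_setOf_eq] at this
      linarith
    · refine ⟨1, one_pos, fun p hp ↦ ?_⟩
      exact absurd ⟨p, hp⟩ hne
  refine ⟨m, hm, fun z w hz₁ hz₂ hnull htan ↦ ?_⟩
  by_cases hw : w = 0
  · subst hw; simp
  -- normalise: translate to the slice and rescale `w`
  set t : ℝ := z 0 with ht
  set z' : E4 := z + (-t) • E4.basisVector 0 with hz'
  clear_value t
  have hrad : Kerr.radius a z' = Kerr.radius a z := Kerr.radius_add_time_smul_basisVector a z (-t)
  have hbil : Kerr.bilin M a z' = Kerr.bilin M a z := Kerr.bilin_add_time M a (-t) z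
  have hfd : fderiv ℝ (Kerr.radius a) z' = fderiv ℝ (Kerr.radius a) z :=
    SwallowTheDatum.KerrShieldedSettles.KerrExteriorFlatDecay.fderiv_radius_add_time a z (-t)
  have hhess : hessAt (Kerr.bilin M a) (Kerr.radius a) z' = hessAt (Kerr.bilin M a) (Kerr.radius a) z :=
    kerrCylindersExactMargin_hessAt_add_time M a z (-t)
  have hz'0 : z' 0 = 0 := by
    simp [hz', ht, E4.basisVector]
  clear_value z'
  set c : ℝ := ‖w‖ with hc
  have hc0 : 0 < c := by rw [hc]; exact norm_pos_iff.2 hw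
  clear_value c
  set v : E4 := c⁻¹ • w with hv
  clear_value v
  have hv1 : ‖v‖ = 1 := by
    rw [hv, norm_smul, norm_inv, Real.norm_eq_abs, abs_of_pos hc0, ← hc, inv_mul_cancel₀ hc0.ne']
  have hwv : w = c • v := by
    rw [hv, smul_smul, mul_inv_cancel₀ hc0.ne', one_smul]
  have hnull' : Kerr.bilin M a z' v v = 0 := by
    rw [hbil, hv, map_smul, map_smul, smul_apply, smul_eq_mul, smul_eq_mul, hnull, mul_zero,
      mul_zero]
  have htan' : fderiv ℝ (Kerr.radius a) z' v = 0 := by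
    rw [hfd, hv, map_smul, smul_eq_mul, htan, mul_zero]
  have hmem : (z', v) ∈ K := ⟨⟨hz'0, hrad ▸ hz₁, hrad ▸ hz₂⟩, hv1, hnull', htan'⟩
  have hle : m ≤ hessAt (Kerr.bilin M a) (Kerr.radius a) z v v := by
    have := hmK _ hmem
    simp only [hF] at this
    rwa [hhess] at this
  have hsc : hessAt (Kerr.bilin M a) (Kerr.radius a) z w w =
      c ^ 2 * hessAt (Kerr.bilin M a) (Kerr.radius a) z v v := by
    rw [hwv]
    simp only [map_smul, smul_apply, smul_eq_mul]
    ring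
  rw [hsc]
  nlinarith [sq_nonneg c]

end Summit.FinalStateConjecture.FinalStateConjecture.Theorems

end
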